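import Mathlib
import Summits.NavierStokesRegularity.FluidComputer.TransportGalerkinBox
import Summits.NavierStokesRegularity.FluidComputer.TransportLinearisedLattice
import Literature.Analysis.FunctionSpaces.LatticeDiffOpAdjoint
import HarnessLib

/-!
# The transport Galerkin model: rapidly decreasing elements and the box suprema (instab g17, cell `ns-blowup`, 2026-08-27)

HONEST FRAMING (human ruling D-0035): nothing here is a claim about Navier–Stokes blow-up.
WHAT THIS IS NOT: not NS evidence — bookkeeping for the model instance «(β2)» of the R-β emergence
chain (`HOME/instab/BETA2-SPEC.md` §5′), for the objects of `TransportGalerkinDefs`: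

* §1 rapidly decreasing coefficient families (the truncated elements of `TransportGalerkinBox`):
  the coefficient-level fields `linCoeff`/`bilCoeff` of rapidly decreasing families are rapidly
  decreasing (host `Uv` rapidly decreasing), so `linOp`/`bilOp` take their defining values there
  (`coe_linOp_of_rapidDecay`, `coe_bilOp_of_rapidDecay`); linearity `linCoeff_sub` and the bilinear
  split `bilCoeff_sub_split` (`Lattice.conv_sub` / `sub_conv` on tempered families);
* §2 the box suprema entering the (C2) constants: for `x ∈ W = box ρ π P`,
  `A₃(Λ⁻² ⇑x) = ∑_l ⟨l⟩³‖(Λ⁻²⇑x) l‖ ≤ ∑_l ⟨l⟩ρ_l` (`weightThree_unscale_le`) and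
  `A₂(scal (π_j ∘ Λ⁻² ⇑x)) ≤ ∑_l ⟨l⟩ρ_l` (`symbNorm_two_scal_comp_le`).

Consumed by `TransportGalerkinOneSided` (condition (C2)). Mathlib + the tree files cited; no new
definitions.
-/

noncomputable section

namespace Summit.NavierStokesRegularity.FluidComputer.TransportGalerkinRapid

open Set Filter Topology Finset
open Literature.Analysis.FunctionSpaces Literature.Analysis.FunctionSpaces.Lattice
open Literature.Analysis.FunctionSpaces.Torus Literature.Analysis.ODE
open Summit.NavierStokesRegularity.FluidComputer.GalerkinLatticePhaseSpace
open Summit.NavierStokesRegularity.FluidComputer.TransportGalerkin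
open Summit.NavierStokesRegularity.FluidComputer.TransportGalerkinBox
open Summit.NavierStokesRegularity.FluidComputer.TransportCommutatorLattice
open Summit.NavierStokesRegularity.FluidComputer.TransportSkewLattice
open Summit.NavierStokesRegularity.FluidComputer.TransportLinearisedLattice
open scoped ENNReal NNReal ComplexConjugate InnerProductSpace

variable {d : Type*} [Fintype d] [DecidableEq d]
variable {V : Type*} [NormedAddCommGroup V] [InnerProductSpace ℂ V] [CompleteSpace V]

/-! ## §1 Rapidly decreasing families: the fields take their defining values -/

section Rapid

omit [DecidableEq d] [InnerProductSpace ℂ V] [CompleteSpace V] in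
/-- `Λ^s` preserves rapid decay. -/
theorem rapidDecay_wmul [NormedSpace ℂ V] {c : (d → ℤ) → V} (hc : RapidDecay c) (s : ℝ) :
    RapidDecay (wmul s c) := by
  rw [rapidDecay_iff_forall_eNormSq_lt_top] at hc ⊢
  intro m
  rw [eNormSq_wmul]
  obtain ⟨n, hn⟩ := exists_nat_ge ((m : ℝ) + s)
  exact (eNormSq_mono hn _).trans_lt (hc n)

omit [DecidableEq d] [InnerProductSpace ℂ V] [CompleteSpace V] in
/-- A modewise contraction preserves rapid decay. -/
theorem rapidDecay_apply [NormedSpace ℂ V] {W' : Type*} [NormedAddCommGroup W'] [NormedSpace ℂ W']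
    (P : (d → ℤ) → (V →L[ℂ] W')) (hP : ∀ k, ‖P k‖ ≤ 1) {c : (d → ℤ) → V} (hc : RapidDecay c) :
    RapidDecay (fun k => P k (c k)) :=
  hc.of_norm_le_mul' (C := 1) fun k =>
    ((P k).le_opNorm _).trans (mul_le_mul_of_nonneg_right (hP k) (norm_nonneg _))

omit [Fintype d] [DecidableEq d] [InnerProductSpace ℂ V] [CompleteSpace V] in
/-- Components through functionals of norm `≤ 1` are dominated by the family. -/
theorem norm_comp_le [NormedSpace ℂ V] (π : d → (V →L[ℂ] ℂ)) (hπ : ∀ j, ‖π j‖ ≤ 1)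
    (u : (d → ℤ) → V) (j : d) (p : d → ℤ) : ‖(fun p => π j (u p)) p‖ ≤ ‖u p‖ :=
  ((π j).le_opNorm (u p)).trans (mul_le_of_le_one_left (norm_nonneg _) (hπ j))

omit [DecidableEq d] [InnerProductSpace ℂ V] [CompleteSpace V] in
/-- The weighted `ℓ¹` norms of a rapidly decreasing family are finite:
`∑_l ⟨l⟩^r ‖c l‖ < ∞`. -/
theorem tsum_weight_mul_enorm_lt_top {c : (d → ℤ) → V} (hc : RapidDecay c) (r : ℝ) :
    ∑' l, ENNReal.ofReal (sobolevWeight r l) * ‖c l‖ₑ < ∞ := by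
  obtain ⟨m, hm⟩ := exists_nat_ge r
  have hle : ∀ k, sobolevWeight r k * ‖c k‖ ≤ (1 + freqNormSq k) ^ m * ‖c k‖ := fun k => by
    refine mul_le_mul_of_nonneg_right ?_ (norm_nonneg _)
    have h1 : 1 ≤ sobolevWeight (m : ℝ) k := one_le_sobolevWeight (Nat.cast_nonneg m) k
    calc sobolevWeight r k ≤ sobolevWeight (m : ℝ) k := sobolevWeight_mono hm k
      _ ≤ sobolevWeight (m : ℝ) k ^ 2 := le_self_pow₀ h1 two_ne_zero
      _ = (1 + freqNormSq k) ^ m := sobolevWeight_natCast_sq m k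
  have hs : Summable fun k => sobolevWeight r k * ‖c k‖ :=
    Summable.of_nonneg_of_le (fun k => by positivity [sobolevWeight_pos r k]) hle (hc m)
  have heq : ∑' l, ENNReal.ofReal (sobolevWeight r l) * ‖c l‖ₑ =
      ∑' l, ENNReal.ofReal (sobolevWeight r l * ‖c l‖) :=
    tsum_congr fun l => by rw [ENNReal.ofReal_mul (sobolevWeight_pos _ _).le, ofReal_norm]
  rw [heq, ← ENNReal.ofReal_tsum_of_nonneg (fun k => by positivity [sobolevWeight_pos r k]) hs]
  exact ENNReal.ofReal_lt_top

omit [DecidableEq d] in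
/-- **The linearised field of a rapidly decreasing family is rapidly decreasing** (host rapidly
decreasing). -/
theorem rapidDecay_linCoeff {ν : ℝ} {Uv : (d → ℤ) → V} (hUv : RapidDecay Uv) (π : d → (V →L[ℂ] ℂ))
    {u : (d → ℤ) → V} (hu : RapidDecay u) : RapidDecay (linCoeff ν Uv π u) := by
  rw [linCoeff_eq]
  refine RapidDecay.sub' (RapidDecay.sub' ?_ ?_) ?_
  · exact (RapidDecay.finset_sum _ fun j _ => ((hu.freqDeriv' j).freqDeriv' j)).const_smul _
  · exact RapidDecay.finset_sum _ fun j _ => (hu.freqDeriv' j).conv_right (hUv.comp_apply (π j)).scal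
  · exact RapidDecay.finset_sum _ fun j _ => (hUv.freqDeriv' j).conv_right (hu.comp_apply (π j)).scal

omit [DecidableEq d] in
/-- **The bilinear field of rapidly decreasing families is rapidly decreasing.** -/
theorem rapidDecay_bilCoeff (π : d → (V →L[ℂ] ℂ)) {u v : (d → ℤ) → V}
    (hu : RapidDecay u) (hv : RapidDecay v) : RapidDecay (bilCoeff π u v) := by
  rw [bilCoeff_eq]
  exact (RapidDecay.finset_sum (Finset.univ : Finset d) fun j _ =>
    (hv.freqDeriv' j).conv_right (hu.comp_apply (π j)).scal).neg'

omit [DecidableEq d] [InnerProductSpace ℂ V] [CompleteSpace V] in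
/-- A rapidly decreasing family, contracted modewise and scaled by `Λ²`, has finite `H⁰` norm. -/
theorem eNormSq_zero_wmul_apply_lt_top [NormedSpace ℂ V] (P : (d → ℤ) → (V →L[ℂ] V))
    (hP : ∀ k, ‖P k‖ ≤ 1) {f : (d → ℤ) → V} (hf : RapidDecay f) :
    eNormSq 0 (wmul 2 fun k => P k (f k)) < ∞ := by
  rw [eNormSq_wmul, zero_add]
  exact (eNormSq_apply_le_of_opNorm_le_one P hP 2 f).trans_lt (eNormSq_lt_top_of_rapidDecay hf 2)

omit [DecidableEq d] in
/-- **`linOp` takes its defining value on rapidly decreasing elements.** -/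
theorem coe_linOp_of_rapidDecay {ν : ℝ} {Uv : (d → ℤ) → V} (hUv : RapidDecay Uv)
    {π : d → (V →L[ℂ] ℂ)} {P : (d → ℤ) → (V →L[ℂ] V)} (hP : ∀ k, ‖P k‖ ≤ 1)
    {x : lp (fun _ : (d → ℤ) => V) 2} (hx : RapidDecay (⇑x)) :
    ⇑(linOp ν Uv π P x) = wmul 2 fun k => P k (linCoeff ν Uv π (wmul (-2) ⇑x) k) :=
  coe_linOp (eNormSq_zero_wmul_apply_lt_top P hP
    (rapidDecay_linCoeff hUv π (rapidDecay_wmul hx (-2))))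

omit [DecidableEq d] in
/-- **`bilOp` takes its defining value on rapidly decreasing elements.** -/
theorem coe_bilOp_of_rapidDecay {π : d → (V →L[ℂ] ℂ)}
    {P : (d → ℤ) → (V →L[ℂ] V)} (hP : ∀ k, ‖P k‖ ≤ 1) {x y : lp (fun _ : (d → ℤ) => V) 2}
    (hx : RapidDecay (⇑x)) (hy : RapidDecay (⇑y)) :
    ⇑(bilOp π P x y) = wmul 2 fun k => P k (bilCoeff π (wmul (-2) ⇑x) (wmul (-2) ⇑y) k) :=
  coe_bilOp (eNormSq_zero_wmul_apply_lt_top P hP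
    (rapidDecay_bilCoeff π (rapidDecay_wmul hx (-2)) (rapidDecay_wmul hy (-2))))

omit [DecidableEq d] [CompleteSpace V] in
/-- `Λ^s` is additive. -/
theorem wmul_sub (s : ℝ) (c c' : (d → ℤ) → V) :
    wmul s (c - c') = wmul s c - wmul s c' := by
  funext k; simp only [wmul_apply, Pi.sub_apply, smul_sub]

omit [Fintype d] [DecidableEq d] [CompleteSpace V] in
/-- Components of a difference. -/
theorem comp_sub (π : d → (V →L[ℂ] ℂ)) (j : d) (u v : (d → ℤ) → V) :
    (fun p => π j ((u - v) p)) = (fun p => π j (u p)) - fun p => π j (v p) := by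
  funext p; simp only [Pi.sub_apply, map_sub]

omit [DecidableEq d] in
/-- **Linearity of the linearised field** on rapidly decreasing families (host rapidly decreasing). -/
theorem linCoeff_sub {ν : ℝ} {Uv : (d → ℤ) → V} (hUv : RapidDecay Uv) (π : d → (V →L[ℂ] ℂ))
    {u v : (d → ℤ) → V} (hu : RapidDecay u) (hv : RapidDecay v) :
    linCoeff ν Uv π (u - v) = linCoeff ν Uv π u - linCoeff ν Uv π v := by
  simp only [linCoeff_eq]
  have h1 : (∑ j, freqDeriv j (freqDeriv j (u - v))) =
      (∑ j, freqDeriv j (freqDeriv j u)) - ∑ j, freqDeriv j (freqDeriv j v) := by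
    rw [← Finset.sum_sub_distrib]
    exact Finset.sum_congr rfl fun j _ => by rw [freqDeriv_sub, freqDeriv_sub]
  have h2 : (∑ j, conv (scal (fun p => π j (Uv p)) : (d → ℤ) → (V →L[ℂ] V)) (freqDeriv j (u - v))) =
      (∑ j, conv (scal (fun p => π j (Uv p))) (freqDeriv j u)) -
        ∑ j, conv (scal (fun p => π j (Uv p))) (freqDeriv j v) := by
    rw [← Finset.sum_sub_distrib]
    refine Finset.sum_congr rfl fun j _ => ?_
    rw [freqDeriv_sub, conv_sub (hUv.comp_apply (π j)).scal (hu.freqDeriv' j).tempered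
      (hv.freqDeriv' j).tempered]
  have h3 : (∑ j, conv (scal (fun p => π j ((u - v) p)) : (d → ℤ) → (V →L[ℂ] V)) (freqDeriv j Uv)) =
      (∑ j, conv (scal (fun p => π j (u p))) (freqDeriv j Uv)) -
        ∑ j, conv (scal (fun p => π j (v p))) (freqDeriv j Uv) := by
    rw [← Finset.sum_sub_distrib]
    refine Finset.sum_congr rfl fun j _ => ?_
    rw [comp_sub, scal_sub, sub_conv (hu.comp_apply (π j)).scal (hv.comp_apply (π j)).scal
      (hUv.freqDeriv' j).tempered]
  rw [h1, h2, h3, smul_sub]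
  abel

omit [DecidableEq d] in
/-- **The bilinear split** `B(u,u) − B(v,v) = B(u − v, u) + B(v, u − v)` on rapidly decreasing
families. -/
theorem bilCoeff_sub_split (π : d → (V →L[ℂ] ℂ)) {u v : (d → ℤ) → V}
    (hu : RapidDecay u) (hv : RapidDecay v) :
    bilCoeff π u u - bilCoeff π v v = bilCoeff π (u - v) u + bilCoeff π v (u - v) := by
  simp only [bilCoeff_eq]
  have h1 : ∀ j, conv (scal (fun p => π j ((u - v) p)) : (d → ℤ) → (V →L[ℂ] V)) (freqDeriv j u) =
      conv (scal (fun p => π j (u p))) (freqDeriv j u) - conv (scal (fun p => π j (v p))) (freqDeriv j u) :=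
    fun j => by
      rw [comp_sub, scal_sub, sub_conv (hu.comp_apply (π j)).scal (hv.comp_apply (π j)).scal
        (hu.freqDeriv' j).tempered]
  have h2 : ∀ j, conv (scal (fun p => π j (v p)) : (d → ℤ) → (V →L[ℂ] V)) (freqDeriv j (u - v)) =
      conv (scal (fun p => π j (v p))) (freqDeriv j u) - conv (scal (fun p => π j (v p))) (freqDeriv j v) :=
    fun j => by
      rw [freqDeriv_sub, conv_sub (hv.comp_apply (π j)).scal (hu.freqDeriv' j).tempered (hv.freqDeriv' j).tempered]
  simp only [h1, h2, Finset.sum_sub_distrib]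
  abel

end Rapid

/-! ## §2 The box suprema -/

section BoxSuprema

omit [DecidableEq d] [CompleteSpace V] in
/-- Coefficients of the unscaled family of a box element: `‖(Λ⁻² ⇑x) l‖ ≤ ⟨l⟩⁻² ρ_l`. -/
theorem norm_unscale_apply_le {ρ : (d → ℤ) → ℝ} {π : d → (V →L[ℂ] ℂ)} {P : (d → ℤ) → (V →L[ℂ] V)}
    {x : lp (fun _ : (d → ℤ) => V) 2} (hx : x ∈ box ρ π P) (l : d → ℤ) :
    ‖wmul (-2) (⇑x) l‖ ≤ sobolevWeight (-2) l * ρ l := by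
  rw [norm_wmul_apply]
  exact mul_le_mul_of_nonneg_left (hx.1 l) (sobolevWeight_pos _ _).le

omit [DecidableEq d] [CompleteSpace V] in
/-- **`A₃` on the box**: `A₃(Λ⁻² ⇑x) = ∑_l ⟨l⟩³ ‖(Λ⁻² ⇑x) l‖ ≤ ∑_l ⟨l⟩ ρ_l` for `x ∈ W`. -/
theorem weightThree_unscale_le {ρ : (d → ℤ) → ℝ} (hρ0 : ∀ k, 0 ≤ ρ k)
    (hρ1 : Summable fun k => sobolevWeight 1 k * ρ k) {π : d → (V →L[ℂ] ℂ)}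
    {P : (d → ℤ) → (V →L[ℂ] V)} {x : lp (fun _ : (d → ℤ) => V) 2} (hx : x ∈ box ρ π P) :
    ∑' l, ENNReal.ofReal (sobolevWeight 3 l) * ‖wmul (-2) (⇑x) l‖ₑ ≤
      ENNReal.ofReal (∑' l, sobolevWeight 1 l * ρ l) := by
  have hterm : ∀ l, ENNReal.ofReal (sobolevWeight 3 l) * ‖wmul (-2) (⇑x) l‖ₑ ≤
      ENNReal.ofReal (sobolevWeight 1 l * ρ l) := fun l => by
    rw [← ofReal_norm, ← ENNReal.ofReal_mul (sobolevWeight_pos _ _).le]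
    refine ENNReal.ofReal_le_ofReal ?_
    calc sobolevWeight 3 l * ‖wmul (-2) (⇑x) l‖
        ≤ sobolevWeight 3 l * (sobolevWeight (-2) l * ρ l) :=
          mul_le_mul_of_nonneg_left (norm_unscale_apply_le hx l) (sobolevWeight_pos _ _).le
      _ = sobolevWeight 1 l * ρ l := by
          rw [← mul_assoc, ← sobolevWeight_add]; norm_num
  calc ∑' l, ENNReal.ofReal (sobolevWeight 3 l) * ‖wmul (-2) (⇑x) l‖ₑ
      ≤ ∑' l, ENNReal.ofReal (sobolevWeight 1 l * ρ l) := ENNReal.tsum_le_tsum hterm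
    _ = ENNReal.ofReal (∑' l, sobolevWeight 1 l * ρ l) :=
        (ENNReal.ofReal_tsum_of_nonneg (fun l => mul_nonneg (sobolevWeight_pos _ _).le (hρ0 l)) hρ1).symm

omit [DecidableEq d] [CompleteSpace V] in
/-- **`A₂` of the advecting components on the box**: `A₂(scal (π_j ∘ Λ⁻² ⇑x)) ≤ ∑_l ⟨l⟩ ρ_l`. -/
theorem symbNorm_two_scal_comp_le {ρ : (d → ℤ) → ℝ} (hρ0 : ∀ k, 0 ≤ ρ k)
    (hρ1 : Summable fun k => sobolevWeight 1 k * ρ k) {π : d → (V →L[ℂ] ℂ)} (hπ : ∀ j, ‖π j‖ ≤ 1)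
    {P : (d → ℤ) → (V →L[ℂ] V)} {x : lp (fun _ : (d → ℤ) => V) 2} (hx : x ∈ box ρ π P) (j : d) :
    symbNorm 2 (scal (fun p => π j (wmul (-2) (⇑x) p)) : (d → ℤ) → (V →L[ℂ] V)) ≤
      ENNReal.ofReal (∑' l, sobolevWeight 1 l * ρ l) := by
  have hterm : ∀ l, ENNReal.ofReal (sobolevWeight 2 l) *
      ‖(scal (fun p => π j (wmul (-2) (⇑x) p)) : (d → ℤ) → (V →L[ℂ] V)) l‖ₑ ≤
      ENNReal.ofReal (sobolevWeight 1 l * ρ l) := fun l => by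
    rw [← ofReal_norm, ← ENNReal.ofReal_mul (sobolevWeight_pos _ _).le]
    refine ENNReal.ofReal_le_ofReal ?_
    have h1 : ‖(scal (fun p => π j (wmul (-2) (⇑x) p)) : (d → ℤ) → (V →L[ℂ] V)) l‖ ≤
        sobolevWeight (-2) l * ρ l := by
      rw [scal_apply, ContinuousLinearMap.one_def, norm_smul]
      calc ‖π j (wmul (-2) (⇑x) l)‖ * ‖ContinuousLinearMap.id ℂ V‖
          ≤ ‖π j (wmul (-2) (⇑x) l)‖ * 1 :=
            mul_le_mul_of_nonneg_left ContinuousLinearMap.norm_id_le (norm_nonneg _)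
        _ ≤ sobolevWeight (-2) l * ρ l := by
            rw [mul_one]; exact (norm_comp_le π hπ _ j l).trans (norm_unscale_apply_le hx l)
    have hρl : ρ l ≤ sobolevWeight 1 l * ρ l :=
      le_mul_of_one_le_left (hρ0 l) (one_le_sobolevWeight zero_le_one l)
    calc sobolevWeight 2 l * ‖(scal (fun p => π j (wmul (-2) (⇑x) p)) : (d → ℤ) → (V →L[ℂ] V)) l‖
        ≤ sobolevWeight 2 l * (sobolevWeight (-2) l * ρ l) :=
          mul_le_mul_of_nonneg_left h1 (sobolevWeight_pos _ _).le
      _ = ρ l := by rw [← mul_assoc, ← sobolevWeight_add]; norm_num [sobolevWeight_zero]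
      _ ≤ sobolevWeight 1 l * ρ l := hρl
  calc symbNorm 2 (scal (fun p => π j (wmul (-2) (⇑x) p)) : (d → ℤ) → (V →L[ℂ] V))
      ≤ ∑' l, ENNReal.ofReal (sobolevWeight 1 l * ρ l) := ENNReal.tsum_le_tsum hterm
    _ = ENNReal.ofReal (∑' l, sobolevWeight 1 l * ρ l) :=
        (ENNReal.ofReal_tsum_of_nonneg (fun l => mul_nonneg (sobolevWeight_pos _ _).le (hρ0 l)) hρ1).symm

end BoxSuprema


end Summit.NavierStokesRegularity.FluidComputer.TransportGalerkinRapid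

end
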